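import Mathlib
import Summits.NavierStokesRegularity.NavierStokesRegularity.Theorems.EulerZoomLiouvillePowerGaugeEulerLiouvilleWeakVorticityRenormLimit
import Summits.NavierStokesRegularity.NavierStokesRegularity.Theorems.EulerZoomLiouvillePowerGaugeEulerLiouvilleWeakEtaRenormalisationMember
import HarnessLib

/-!
# Crux `EulerZoomLiouville.PowerGaugeEulerLiouville` (stmt-NavierStokesRegularity-19832), weak stratum, line `weak_eulerian`:
# E2 `stub_renormalisation` — THE WEAK VORTICITY IS A RENORMALISED SOLUTION (member, UNCONDITIONAL)

Route №10 `EulerZoomLiouville` (NavierStokesRegularity), crux E = stmt-NavierStokesRegularity-19832; width seat ns-ezl-w2 g7 under the LEAD ns-typeII-p2.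
The line's stub E2 (`Sig.stub_renormalisation` of `Cruxes/PowerGaugeEulerLiouville/Lines/weak_eulerian.lean`): an `L²_loc` distributional solution
`Ω = curlCLM ∘ G` of the weak vorticity equation `div(W ⊗ Ω) = (3γ−1)Ω + GΩ` (`W = γy + V ∈ W^{1,2}_loc`, `div W = 3γ`, `γ = 1/(2+ρ)`) is RENORMALISED:
for every `β ∈ C¹(ℝ³; ℝ)` bounded with bounded derivative and every test `ψ`,

  `∫ β(Ω)(3γψ + Dψ[W]) = ∫ ψ Dβ(Ω)[Ω − GΩ]`.

This is `hasRenormalised_core` (`…WeakVorticityRenormLimit`, DiPerna–Lions 1989 Thm. II.1 over the commutator Lemma II.1 = the tree's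
`Literature.Analysis.FunctionSpaces.DiPernaLionsCommutatorL2_holds`) with `c = 3γ`, `Θ = Ω`, `S = (1−3γ)Ω − GΩ` (so `cΘ + S = Ω − GΩ`); the data
(`Ω, W, DW = γ·id + G ∈ L²_loc`, `tr DW = 3γ` a.e., `S ∈ L¹_loc`) come from the line's `IsProfileGradient` / `HasTransportDivergence` binders exactly as in
ns-ezl-w1's X1b member (`WeakAxisym.isWeaklyDivFree_of_transportDivergence`, `IsWeaklyDivFree.trace_weakGradient_ae_eq_zero`, `WeakAxisym.memLp_drift_ball`).

* `WeakEulerian.renormalisation` — **`Sig.stub_renormalisation` with the line's reducible binders δ-unfolded** (the line fills it by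
  `intro ρ hρ hρh V G hG hdiv hvort; exact WeakEulerian.renormalisation hρ hρh hG hdiv hvort`).
[folklore; DiPernaLions1989 Thm. II.1 and Lemma II.1; AmbrosioCrippa2008 Thm 24 / Prop. 25]

WHAT THIS IS NOT: not NS regularity, not crux E, not the weak stub: a line-stub member of the weak stratum (E2 of `weak_eulerian`, the vector twin of
X1b of `weak_axisym`); 19832 is OPEN.  The `0 < ρ ≤ 1/2` binders are carried unused (the theorem holds for every `ρ ≠ -2`).
-/

noncomputable section

-- flat `Theorems/<Route><Decl>…` files of one crux share the namespace of the crux (tree convention)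
set_option linter.dupNamespace false

open MeasureTheory Set Filter Topology Metric Function TopologicalSpace ContinuousLinearMap
open scoped ENNReal NNReal RealInnerProductSpace ContDiff Convolution

namespace Summit.NavierStokesRegularity.NavierStokesRegularity.Theorems.PowerGaugeEulerLiouville.WeakEulerian

open Literature.Analysis Literature.Analysis.FunctionSpaces Literature.Analysis.FluidPDE
open Summit.NavierStokesRegularity.NavierStokesRegularity.Theorems.PowerGaugeEulerLiouville

variable {V : EuclideanSpace ℝ (Fin 3) → EuclideanSpace ℝ (Fin 3)} {G : EuclideanSpace ℝ (Fin 3) → EuclideanSpace ℝ (Fin 3) →L[ℝ] EuclideanSpace ℝ (Fin 3)}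

/-- **E2 — THE WEAK VORTICITY OF A POWER-GAUGED SELF-SIMILAR PROFILE IS A RENORMALISED SOLUTION** (`Sig.stub_renormalisation` of
`Lines/weak_eulerian.lean`, δ-unfolded; UNCONDITIONAL).  See the module docstring. [folklore; DiPernaLions1989 Thm. II.1] -/
theorem renormalisation {ρ : ℝ} (_hρ : 0 < ρ) (_hρh : ρ ≤ 1 / 2)
    (hPG : HasWeakFDerivOn (⊤ : Opens (EuclideanSpace ℝ (Fin 3))) volume V G ∧
      (∀ r : ℝ, MemLp G 2 (volume.restrict (ball (0 : EuclideanSpace ℝ (Fin 3)) r))) ∧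
      (∀ r : ℝ, MemLp V 6 (volume.restrict (ball (0 : EuclideanSpace ℝ (Fin 3)) r))) ∧
      HasWeakFDerivOn (⊤ : Opens (EuclideanSpace ℝ (Fin 3))) volume (selfSimilarTransport (1 / (2 + ρ)) 0 V)
        (fun x => (1 / (2 + ρ)) • ContinuousLinearMap.id ℝ (EuclideanSpace ℝ (Fin 3)) + G x))
    (hdiv : ∀ φ : EuclideanSpace ℝ (Fin 3) → ℝ, IsTestFunctionOn (⊤ : Opens (EuclideanSpace ℝ (Fin 3))) φ →
      ∫ y, inner ℝ (selfSimilarTransport (1 / (2 + ρ)) 0 V y) (gradient φ y) = -(3 * (1 / (2 + ρ))) * ∫ y, φ y)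
    (hvort : ∀ ψ : EuclideanSpace ℝ (Fin 3) → ℝ, IsTestFunctionOn (⊤ : Opens (EuclideanSpace ℝ (Fin 3))) ψ →
      ∀ e : EuclideanSpace ℝ (Fin 3),
        ∫ y, inner ℝ (curlCLM (G y)) e * fderiv ℝ ψ y (selfSimilarTransport (1 / (2 + ρ)) 0 V y) =
          ∫ y, ψ y * inner ℝ ((1 - 3 * (1 / (2 + ρ))) • curlCLM (G y) - G y (curlCLM (G y))) e) :
    ∀ β : EuclideanSpace ℝ (Fin 3) → ℝ, ContDiff ℝ 1 β →
      (∃ C : ℝ, ∀ w : EuclideanSpace ℝ (Fin 3), ‖β w‖ ≤ C ∧ ‖fderiv ℝ β w‖ ≤ C) →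
      ∀ ψ : EuclideanSpace ℝ (Fin 3) → ℝ, IsTestFunctionOn (⊤ : Opens (EuclideanSpace ℝ (Fin 3))) ψ →
        ∫ y, β (curlCLM (G y)) * (3 * (1 / (2 + ρ)) * ψ y + fderiv ℝ ψ y (selfSimilarTransport (1 / (2 + ρ)) 0 V y)) =
          ∫ y, ψ y * fderiv ℝ β (curlCLM (G y)) (curlCLM (G y) - G y (curlCLM (G y))) := by
  intro β hβ hβb ψ hψ
  obtain ⟨C, hC⟩ := hβb
  obtain ⟨hVG, hG2, hV6, hWG⟩ := hPG
  -- ### names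
  obtain ⟨γ, hγ⟩ : ∃ γ : ℝ, γ = 1 / (2 + ρ) := ⟨_, rfl⟩
  rw [← hγ] at hWG hdiv hvort ⊢
  obtain ⟨W, hW⟩ : ∃ W : EuclideanSpace ℝ (Fin 3) → EuclideanSpace ℝ (Fin 3), W = selfSimilarTransport γ 0 V := ⟨_, rfl⟩
  obtain ⟨DW, hDW⟩ : ∃ DW : EuclideanSpace ℝ (Fin 3) → EuclideanSpace ℝ (Fin 3) →L[ℝ] EuclideanSpace ℝ (Fin 3),
      DW = fun x => γ • ContinuousLinearMap.id ℝ (EuclideanSpace ℝ (Fin 3)) + G x := ⟨_, rfl⟩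
  obtain ⟨Θ, hΘ⟩ : ∃ Θ : EuclideanSpace ℝ (Fin 3) → EuclideanSpace ℝ (Fin 3), Θ = fun y => curlCLM (G y) := ⟨_, rfl⟩
  obtain ⟨S, hS⟩ : ∃ S : EuclideanSpace ℝ (Fin 3) → EuclideanSpace ℝ (Fin 3), S = fun y => (1 - 3 * γ) • Θ y - G y (Θ y) := ⟨_, rfl⟩
  rw [← hDW, ← hW] at hWG
  rw [← hW] at hdiv hvort ⊢
  -- ### data
  have hfin : ∀ r : ℝ, IsFiniteMeasure ((volume : Measure (EuclideanSpace ℝ (Fin 3))).restrict (ball (0 : EuclideanSpace ℝ (Fin 3)) r)) :=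
    fun r => isFiniteMeasure_restrict.2 measure_ball_lt_top.ne
  have hVl : LocallyIntegrable V volume := locallyIntegrableOn_univ.1 (by
    simpa only [Opens.coe_top] using hVG.locallyIntegrableOn)
  have hGm : AEStronglyMeasurable G volume := (locallyIntegrableOn_univ.1 (by
    simpa only [Opens.coe_top] using hVG.locallyIntegrableOn_deriv)).aestronglyMeasurable
  have hV2 : ∀ r : ℝ, MemLp V 2 (volume.restrict (ball (0 : EuclideanSpace ℝ (Fin 3)) r)) := fun r => by
    haveI := hfin r
    exact (hV6 r).mono_exponent (by norm_num)
  have hW2 : ∀ r : ℝ, MemLp W 2 (volume.restrict (ball (0 : EuclideanSpace ℝ (Fin 3)) r)) := fun r => by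
    rw [hW]
    exact (WeakAxisym.memLp_drift_ball γ r).add (hV2 r)
  have hDWm : AEStronglyMeasurable DW volume := by
    rw [hDW]; exact aestronglyMeasurable_const.add hGm
  have hDW2 : ∀ r : ℝ, MemLp DW 2 (volume.restrict (ball (0 : EuclideanSpace ℝ (Fin 3)) r)) := fun r => by
    haveI := hfin r
    have href : MemLp (fun x => (1 : ℝ) + ‖G x‖) 2 (volume.restrict (ball (0 : EuclideanSpace ℝ (Fin 3)) r)) :=
      (memLp_const (1 : ℝ)).add (hG2 r).norm
    refine MemLp.of_le_mul (c := max ‖γ • ContinuousLinearMap.id ℝ (EuclideanSpace ℝ (Fin 3))‖ 1) href hDWm.restrict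
      (Eventually.of_forall fun x => ?_)
    have hn : ‖(1 : ℝ) + ‖G x‖‖ = 1 + ‖G x‖ := by rw [Real.norm_eq_abs]; exact abs_of_nonneg (by positivity)
    rw [hn, hDW]
    calc ‖γ • ContinuousLinearMap.id ℝ (EuclideanSpace ℝ (Fin 3)) + G x‖
        ≤ ‖γ • ContinuousLinearMap.id ℝ (EuclideanSpace ℝ (Fin 3))‖ + ‖G x‖ := norm_add_le _ _
      _ ≤ max ‖γ • ContinuousLinearMap.id ℝ (EuclideanSpace ℝ (Fin 3))‖ 1 * 1 +
            max ‖γ • ContinuousLinearMap.id ℝ (EuclideanSpace ℝ (Fin 3))‖ 1 * ‖G x‖ := by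
          refine add_le_add (by rw [mul_one]; exact le_max_left _ _) ?_
          exact le_mul_of_one_le_left (norm_nonneg _) (le_max_right _ _)
      _ = max ‖γ • ContinuousLinearMap.id ℝ (EuclideanSpace ℝ (Fin 3))‖ 1 * (1 + ‖G x‖) := by ring
  have hΘ2 : ∀ r : ℝ, MemLp Θ 2 (volume.restrict (ball (0 : EuclideanSpace ℝ (Fin 3)) r)) := fun r => by
    rw [hΘ]
    exact MemLp.of_le_mul (c := ‖(curlCLM : (EuclideanSpace ℝ (Fin 3) →L[ℝ] EuclideanSpace ℝ (Fin 3)) →L[ℝ] EuclideanSpace ℝ (Fin 3))‖)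
      (hG2 r) (curlCLM.continuous.comp_aestronglyMeasurable (hG2 r).1) (Eventually.of_forall fun y => curlCLM.le_opNorm _)
  have hΘm : AEStronglyMeasurable Θ volume := by
    rw [hΘ]; exact curlCLM.continuous.comp_aestronglyMeasurable hGm
  -- `tr DW = 3γ` a.e.
  have hdivV : IsWeaklyDivFree V := WeakAxisym.isWeaklyDivFree_of_transportDivergence hVl (by rw [← hW]; exact hdiv)
  have htr : ∀ᵐ x ∂(volume : Measure (EuclideanSpace ℝ (Fin 3))),
      LinearMap.trace ℝ (EuclideanSpace ℝ (Fin 3)) (DW x : EuclideanSpace ℝ (Fin 3) →ₗ[ℝ] EuclideanSpace ℝ (Fin 3)) = 3 * γ := by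
    filter_upwards [hdivV.trace_weakGradient_ae_eq_zero hVG] with x hx
    rw [hDW]
    rw [ContinuousLinearMap.toLinearMap_add, map_add, ContinuousLinearMap.toLinearMap_smul, map_smul, hx, add_zero, ContinuousLinearMap.coe_id,
      LinearMap.trace_id, finrank_euclideanSpace, Fintype.card_fin, smul_eq_mul]
    push_cast
    ring
  -- the source `S = (1−3γ)Θ − GΘ ∈ L¹_loc`
  have hGΘl : LocallyIntegrable (fun y => G y (Θ y)) volume := by
    have hm : AEStronglyMeasurable (fun y => G y (Θ y)) volume :=
      Continuous.comp_aestronglyMeasurable₂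
        (g := fun (L : EuclideanSpace ℝ (Fin 3) →L[ℝ] EuclideanSpace ℝ (Fin 3)) (v : EuclideanSpace ℝ (Fin 3)) => L v)
        (isBoundedBilinearMap_apply (𝕜 := ℝ) (E := EuclideanSpace ℝ (Fin 3)) (F := EuclideanSpace ℝ (Fin 3))).continuous hGm hΘm
    have hprod : LocallyIntegrable (fun y => ‖G y‖ * ‖Θ y‖) volume :=
      WeakAxisym.locallyIntegrable_mul_norm (fun r => (hG2 r).norm) hΘ2
    exact hprod.mono hm (Eventually.of_forall fun y => by
      rw [Real.norm_eq_abs, abs_of_nonneg (by positivity)]; exact (G y).le_opNorm _)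
  have hSl : LocallyIntegrable S volume := by
    rw [hS]
    exact ((locallyIntegrable_of_memLp_two_ball_vec hΘ2).smul (1 - 3 * γ)).sub hGΘl
  -- the componentwise equation with source `S`
  have heq : ∀ ψ : EuclideanSpace ℝ (Fin 3) → ℝ, IsTestFunctionOn (⊤ : Opens (EuclideanSpace ℝ (Fin 3))) ψ →
      ∀ e : EuclideanSpace ℝ (Fin 3), ∫ y, ⟪Θ y, e⟫ * fderiv ℝ ψ y (W y) = ∫ y, ψ y * ⟪S y, e⟫ := by
    intro ψ' hψ' e
    simp only [hΘ, hS]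
    exact hvort ψ' hψ' e
  -- ### the core theorem with `c = 3γ`
  have hcore := hasRenormalised_core (c := 3 * γ) hΘ2 hW2 hWG hDW2 htr hdiv hSl heq hβ (fun w => (hC w).1) (fun w => (hC w).2) hψ
  simp only [hΘ, hS] at hcore
  rw [hcore]
  refine integral_congr_ae (Eventually.of_forall fun y => ?_)
  have e : (3 * γ) • curlCLM (G y) + ((1 - 3 * γ) • curlCLM (G y) - G y (curlCLM (G y))) = curlCLM (G y) - G y (curlCLM (G y)) := by
    rw [← add_sub_assoc, ← add_smul, show 3 * γ + (1 - 3 * γ) = (1 : ℝ) by ring, one_smul]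
  simp only [e]

end Summit.NavierStokesRegularity.NavierStokesRegularity.Theorems.PowerGaugeEulerLiouville.WeakEulerian

end
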